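import Literature.AlgebraicGeometry.HodgeTheory.KugaSatakeClassBetti
import Literature.AlgebraicGeometry.HodgeTheory.BettiUniverseHodgeRiemann
import Literature.AlgebraicGeometry.HodgeTheory.BettiUniverseCMAction
import Literature.AlgebraicGeometry.HodgeTheory.HodgeTypeProjectors
import Literature.AlgebraicGeometry.HodgeTheory.LefschetzOneOneHolds
import Literature.AlgebraicGeometry.HodgeTheory.AlgebraicClassesHodgeTypeHolds
import Literature.AlgebraicGeometry.Motives.HodgeStructureK3TypeOddRank
import Literature.AlgebraicGeometry.Motives.HodgeStructureK3TranscendentalOrthogonal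

/-!
# Squares of surfaces with `p_g = 1` and `b₂ − ρ` an odd prime, I: the transcendental lattice

Crux `K3TypeNets` (stmt-HodgeConjecture-11600) of route NoetherLefschetzOneUp contains `HC(S × S)` for
surfaces `S` with `h^{2,0}(S) = 1` (its `why it might fail`: "for `S` an elliptic K3 with real
multiplication … the crux contains `HC(S×S)` with RM classes in `T(S)⊗T(S)`"). This file and its sequel
(`…K3TypeNetsOddPrimeSquares`) prove, unconditionally: **if `S` is a smooth projective complex surface
with `h^{2,0}(S) = 1` whose transcendental lattice `T(S)_ℚ = NS(S)_ℚ^⊥` has odd PRIME rank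
`b₂(S) − ρ(S)`, then `End_Hdg(T(S)) = ℚ` — no real and no complex multiplication — and the Hodge
conjecture holds for `S × S`.** For K3 surfaces (`b₂ = 22`) this is Picard number
`ρ ∈ {3, 5, 9, 11, 15, 17, 19}`.

This first file works on the rational carriers `H²(S(ℂ); ℚ) = bettiCohomology S 2` with the `ℚ`-Hodge
structure `H²_B(S)` of the real Hodge model (`BettiUniverse.realHodgeModel`, `bettiTwoHodgeStructure`),
the rational intersection form `cupPairingBetti hS = ∫_S (· ∪ ·)` and the transcendental lattice
`transcendentalLatticeBetti = Hdg¹(S)^⊥` (all existing tree definitions, `HodgeTheory/KugaSatakeClassBetti`):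

* `cupPairingBetti_isSymm`, `cupPairingBetti_nondegenerate` (Poincaré duality over `ℂ`, descended);
* `cupPairingBetti_baseChange_apply` — `(∫ ∪)_ℂ = ∫_ℂ ∘ ∪_ℂ`; `hodge_F_apply_eq_zero` — the first
  Hodge–Riemann relation `∫_ℂ F^p ∪ F^{3-p} = 0` (types `(a,b) ∪ (c,d)` with `a + c ≥ 3` vanish on a
  surface); `cupPairingBetti_twoZero_conj_ne_zero` — `∫ σ ∪ σ̄ ≠ 0` (`BettiUniverse.HodgeRiemann20_holds`);
* `isOfK3Type_bettiTwo` — **`H²_B(S)` is of K3 type when `h^{2,0}(S) = 1`**;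
* `exists_transcendental_subHodgeStructure` — **`T(S)_ℚ` underlies an irreducible polarizable sub-Hodge
  structure of K3 type** (Huybrechts Ch. 3 Lemma 3.1 / 2.7, through the tree's abstract
  `isIrreducible_orthogonal_hodgeClasses`), and `finrank_transcendentalLatticeBetti` — its rank is
  `b₂(S) − ρ(S) = dim_ℂ H²(S(ℂ); ℂ) − dim_ℂ N¹H²`;
* `transcendental_endAlg_eq_bot` — **for `b₂ − ρ` an odd prime, `End_Hdg(T(S)_ℚ) = ℚ`**
  (`endAlg_eq_bot_of_prime_of_odd`: Huybrechts Rem. 3.3.14 (ii) with van Geemen's Lemma 3.2).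

No definition, no named-fact hypothesis, no sorry. Prover seat ring2-b02 (gen 48).

References: D. Huybrechts, *Lectures on K3 Surfaces*, Ch. 3 Lemma 3.1, Lemma 2.7, (3.2), Rem. 3.14 (ii);
B. van Geemen, *Real multiplication on K3 surfaces and Kuga–Satake varieties* (2008), Lemma 3.2;
C. Voisin, *Hodge Theory and Complex Algebraic Geometry I*, Thm. 6.32, §7.1, Lemma 7.30.
-/

set_option linter.dupNamespace false

noncomputable section

namespace Summit.HodgeConjecture.HodgeConjecture.Theorems.OddPrimeSquares

open scoped TensorProduct
open CategoryTheory Literature.AlgebraicGeometry Literature.AlgebraicGeometry.Motives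
open Literature.AlgebraicGeometry.HodgeTheory Literature.AlgebraicTopology.SingularHomology
open Literature.AlgebraicGeometry.Motives.HodgeStructure

variable {S : SchemeOver ℂ}

/-- `H²_B(S)`: the weight-two `ℚ`-Hodge structure on `H²(S(ℂ); ℚ)` of the real Hodge model of `S`. -/
local notation3 "H²[" hS "]" =>
  bettiTwoHodgeStructure hS (BettiUniverse.realHodgeModel exists_isReal_hodgeModel_holds hS)
    (BettiUniverse.realHodgeModel_isHodgeSymmetric exists_isReal_hodgeModel_holds hS)

/-- `T(S)_ℚ = Hdg¹^⊥ ⊆ H²(S(ℂ); ℚ)`. -/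
local notation3 "T[" hS "]" =>
  transcendentalLatticeBetti hS (BettiUniverse.realHodgeModel exists_isReal_hodgeModel_holds hS)
    (BettiUniverse.realHodgeModel_isHodgeSymmetric exists_isReal_hodgeModel_holds hS)

/-- `Θ : ℂ ⊗_ℚ H²(S(ℂ); ℚ) → H²(S(ℂ); ℂ)`. -/
local notation3 "Θ[" S "]" => ofRatClassBaseChange (Motives.ComplexPoints S) (2 * 1)

/-! ### The rational intersection form -/

/-- The intersection form `∫_S a ∪ b` on `H²(S(ℂ); ℚ)` is symmetric (graded commutativity in even
degree). [cite: HatcherAT2002, §3.2 Thm. 3.11] -/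
theorem cupPairingBetti_isSymm (hS : IsSmoothProjective 2 S) : (cupPairingBetti hS).IsSymm := by
  refine ⟨fun a b ↦ ?_⟩
  rw [cupPairingBetti_apply, cupPairingBetti_apply,
    cupProduct_gradedComm_holds ℚ (Motives.ComplexPoints S) (show 2 * 1 + 2 * 1 = 2 * 2 from rfl)
      (show 2 * 1 + 2 * 1 = 2 * 2 from rfl) a b]
  norm_num

/-- **The intersection form on `H²(S(ℂ); ℚ)` is non-degenerate** (Poincaré duality: the cup product
pairing of the closed oriented `4`-manifold `S(ℂ)` is perfect over `ℂ`,
`isPerfPair_cupPairing_complexPoints`, descended along the injective `H²(–; ℚ) → H²(–; ℂ)` using that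
rational classes span). [cite: HatcherAT2002, §3.3 Prop. 3.38] [cite: VoisinHodgeI2002, §7.1.1] -/
theorem cupPairingBetti_nondegenerate (hS : IsSmoothProjective 2 S) : (cupPairingBetti hS).Nondegenerate := by
  have h4 : 2 * 1 + 2 * 1 = 2 * 2 := rfl
  have hsymm := cupPairingBetti_isSymm hS
  have hleft : (cupPairingBetti hS).SeparatingLeft := by
    intro x hx
    have h1 : ∀ y : bettiCohomology S (2 * 1),
        cupProduct (X := Motives.ComplexPoints S) (R := ℚ) h4 x y = 0 := fun y ↦
      eq_zero_of_trace_eq_zero hS (by rw [← cupPairingBetti_apply]; exact hx y)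
    -- complexify: `x ⊗ 1` pairs to zero with every complex class
    set xc := singularCohomology.ringChange (algebraMap ℚ ℂ) (Motives.ComplexPoints S) (2 * 1) x with hxc
    have h2 : ∀ z : complexBetti S (2 * 1), cupProduct h4 xc z = 0 := by
      intro z
      obtain ⟨t, rfl⟩ := ofRatClassBaseChange_surjective hS (2 * 1) z
      induction t using TensorProduct.induction_on with
      | zero => rw [map_zero, map_zero]
      | tmul c w =>
        rw [ofRatClassBaseChange_tmul, map_smul, ofRatClass_eq_ringChange, hxc,
          ← singularCohomology.ringChange_cupProduct, h1 w, map_zero, smul_zero]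
      | add t₁ t₂ h₁ h₂ => rw [map_add, map_add, h₁, h₂, add_zero]
    have h3 : xc = 0 := by
      have hP := isPerfPair_cupPairing_complexPoints complexOrientationFamily hS h4
      refine (LinearMap.IsPerfPair.bijective_left (cupPairing (complexOrientationFamily hS) h4)).1 ?_
      rw [map_zero]
      ext z
      rw [cupPairing_apply, h2 z, map_zero, LinearMap.zero_apply, LinearMap.zero_apply]
    apply ofRatClass_injective (2 * 1)
    rw [ofRatClass_eq_ringChange, ← hxc, h3, map_zero]
  refine ⟨hleft, fun y hy ↦ hleft y fun x ↦ ?_⟩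
  rw [hsymm.eq]
  exact hy x

/-- **`(∫ ∪)_ℂ = ∫_ℂ ∘ ∪_ℂ`**: the complexified intersection form is the complexified canonical trace
of the complexified rational cup product (`BettiUniverse.cup`). [cite: VoisinHodgeI2002, §7.1.2] -/
theorem cupPairingBetti_baseChange_apply (hS : IsSmoothProjective 2 S)
    (x y : ℂ ⊗[ℚ] bettiCohomology S (2 * 1)) :
    (cupPairingBetti hS).baseChange ℂ x y =
      TensorProduct.AlgebraTensorModule.rid ℚ ℂ ℂ
        ((trace hS).baseChange ℂ (LinearMap.BilinMap.baseChange ℂ (BettiUniverse.cup S (2 * 1) (2 * 1)) x y)) := by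
  induction x using TensorProduct.induction_on generalizing y with
  | zero => rw [LinearMap.map_zero₂, LinearMap.map_zero₂, map_zero, map_zero]
  | tmul a v =>
    induction y using TensorProduct.induction_on with
    | zero => rw [map_zero, map_zero, map_zero, map_zero]
    | tmul b w =>
      rw [LinearMap.BilinForm.baseChange_tmul, LinearMap.BilinMap.baseChange_tmul,
        LinearMap.baseChange_tmul, TensorProduct.AlgebraTensorModule.rid_tmul, cupPairingBetti_apply]
    | add y₁ y₂ h₁ h₂ => rw [map_add, map_add, h₁, h₂, map_add, map_add]
  | add x₁ x₂ h₁ h₂ =>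
    rw [LinearMap.map_add₂, LinearMap.map_add₂, h₁, h₂, map_add, map_add]

/-- `(∫ ∪)_ℂ(x, y) = 0` whenever `x ∪_ℂ y = 0`. [folklore] -/
theorem cupPairingBetti_baseChange_eq_zero_of_cup (hS : IsSmoothProjective 2 S)
    {x y : ℂ ⊗[ℚ] bettiCohomology S (2 * 1)}
    (h : LinearMap.BilinMap.baseChange ℂ (BettiUniverse.cup S (2 * 1) (2 * 1)) x y = 0) :
    (cupPairingBetti hS).baseChange ℂ x y = 0 := by
  rw [cupPairingBetti_baseChange_apply, h, map_zero, map_zero]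

/-- `x ∪_ℂ y = 0` in `ℂ ⊗_ℚ H⁴(S(ℂ); ℚ)` iff `Θ x ∪ Θ y = 0` in `H⁴(S(ℂ); ℂ)` (`Θ` is multiplicative and
injective). [cite: HatcherAT2002, §3.2 p. 215 and §3.1 p. 198] -/
theorem cup_baseChange_eq_zero_iff (x y : ℂ ⊗[ℚ] bettiCohomology S (2 * 1)) :
    LinearMap.BilinMap.baseChange ℂ (BettiUniverse.cup S (2 * 1) (2 * 1)) x y = 0 ↔
      cupProduct (rfl : 2 * 1 + 2 * 1 = 2 * 2) (Θ[S] x) (Θ[S] y) = 0 := by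
  have h := BettiUniverse.ofRatClassBaseChange_cup2 S (2 * 1) x y
  constructor
  · intro h0
    rw [h0, map_zero] at h
    exact h.symm
  · intro h0
    apply ofRatClassBaseChange_injective (Motives.ComplexPoints S) (2 * 1 + 2 * 1)
    rw [h, map_zero]
    exact h0

/-! ### Hodge types: vanishing beyond the dimension, the first Hodge–Riemann relation -/

/-- **No classes of type `(p, q)` with `p > 2` on a surface**: such a class vanishes.
[cite: VoisinHodgeI2002, §2.3.1 and §6.1] -/
theorem eq_zero_of_isOfHodgeType_of_lt (hS : IsSmoothProjective 2 S) {k p q : ℕ} (hpqk : p + q = k)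
    (hp : 2 < p) {c : complexBetti S k} (hc : IsOfHodgeType 2 S k p q c) : c = 0 := by
  set A := BettiUniverse.realHodgeModel exists_isReal_hodgeModel_holds hS
  have hmem := A.mem_typePiece_of_isOfHodgeType hodgePQ_independent_of_hodgeModel_holds hS
    (Finset.HasAntidiagonal.mem_antidiagonal.2 hpqk) hc
  rwa [A.typePiece_eq_bot_of_lt_fst _ hp, Submodule.mem_bot] at hmem

/-- Same with `q > 2`. [cite: VoisinHodgeI2002, §2.3.1 and §6.1] -/
theorem eq_zero_of_isOfHodgeType_of_lt' (hS : IsSmoothProjective 2 S) {k p q : ℕ} (hpqk : p + q = k)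
    (hq : 2 < q) {c : complexBetti S k} (hc : IsOfHodgeType 2 S k p q c) : c = 0 := by
  set A := BettiUniverse.realHodgeModel exists_isReal_hodgeModel_holds hS
  have hmem := A.mem_typePiece_of_isOfHodgeType hodgePQ_independent_of_hodgeModel_holds hS
    (Finset.HasAntidiagonal.mem_antidiagonal.2 hpqk) hc
  rwa [A.typePiece_eq_bot_of_lt_snd _ hq, Submodule.mem_bot] at hmem

/-- **`F³ H⁴_B(S) = 0`** for a surface: the Hodge filtration of `H⁴(S(ℂ); ℚ)` has no step beyond
`(2,2)` (`H^{3,1} = H^{4,0} = 0`). [cite: VoisinHodgeI2002, §6.1.3 and §7.1.1] -/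
theorem hodge_four_F_three_eq_bot (hS : IsSmoothProjective 2 S) :
    (BettiUniverse.hodge exists_isReal_hodgeModel_holds hS (2 * 1 + 2 * 1)).F 3 = ⊥ := by
  set A := BettiUniverse.realHodgeModel exists_isReal_hodgeModel_holds hS
  rw [BettiUniverse.hodge_F, HodgeModel.ratF_eq_iSup, eq_bot_iff]
  refine iSup_le fun pq ↦ iSup_le fun hp ↦ ?_
  intro x hx
  rw [HodgeModel.mem_ratPiece_iff, HodgeModel.complexification_apply] at hx
  have hab : pq.1.1 + pq.1.2 = 2 * 1 + 2 * 1 := Finset.HasAntidiagonal.mem_antidiagonal.1 pq.2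
  have h0 := eq_zero_of_isOfHodgeType_of_lt hS hab (by push_cast at hp; omega) ⟨A, hx⟩
  rw [Submodule.mem_bot]
  exact ofRatClassBaseChange_injective _ _ (by rw [h0, map_zero])

/-- **First Hodge–Riemann relation for the intersection form**: `(∫ ∪)_ℂ(F^p H², F^{3-p} H²) = 0`
(the product lies in `F³ H⁴ = 0`, `BettiUniverse.cup2_hodge`). [cite: VoisinHodgeI2002, §7.1.2 and Lemma 7.30] -/
theorem hodge_F_apply_eq_zero (hS : IsSmoothProjective 2 S) (p : ℤ)
    (x : ℂ ⊗[ℚ] bettiCohomology S (2 * 1)) (hx : x ∈ (H²[hS]).F p)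
    (y : ℂ ⊗[ℚ] bettiCohomology S (2 * 1)) (hy : y ∈ (H²[hS]).F (3 - p)) :
    (cupPairingBetti hS).baseChange ℂ x y = 0 := by
  apply cupPairingBetti_baseChange_eq_zero_of_cup hS
  have hmem := BettiUniverse.cup2_hodge exists_isReal_hodgeModel_holds hodgePQ_independent_of_hodgeModel_holds
    hS (2 * 1) p (3 - p) x y hx hy
  rw [show p + (3 - p) = 3 by ring, hodge_four_F_three_eq_bot hS, Submodule.mem_bot] at hmem
  exact hmem

/-- **Hodge–Riemann in bidegree `(2,0)`**: `(∫ ∪)_ℂ(σ, conj σ) ≠ 0` for `0 ≠ σ ∈ H^{2,0}` (from the tree's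
theorem `BettiUniverse.hodgeRiemann_two_zero_holds`, whose light trace is a non-zero multiple of the
canonical one; both read `σ ∪ σ̄ ≠ 0`). [cite: VoisinHodgeI2002, §6.3.2 Thm. 6.32] -/
theorem cupPairingBetti_twoZero_conj_ne_zero (hS : IsSmoothProjective 2 S)
    (x : ℂ ⊗[ℚ] bettiCohomology S (2 * 1)) (hx : x ∈ (H²[hS]).piece 2 0) (h0 : x ≠ 0) :
    (cupPairingBetti hS).baseChange ℂ x (HodgeStructure.conj x) ≠ 0 := by
  have hxF : x ∈ (BettiUniverse.hodge exists_isReal_hodgeModel_holds hS 2).F 2 :=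
    HodgeStructure.piece_le_F _ 2 0 hx
  have hHR := BettiUniverse.hodgeRiemann_two_zero_holds hS rfl x hxF h0
  intro h
  apply hHR
  -- `(∫ ∪)_ℂ = rid ∘ (∫ ⊗ ℂ) ∘ ∪_ℂ` vanishes, and `∫ ⊗ ℂ` is injective: so `σ ∪_ℂ σ̄ = 0`
  rw [cupPairingBetti_baseChange_apply, LinearEquiv.map_eq_zero_iff] at h
  have hinj : Function.Injective ((trace hS).baseChange ℂ) :=
    baseChange_injective_of_injective (trace_injective hS)
  have hzero : LinearMap.BilinMap.baseChange ℂ (BettiUniverse.cup S (2 * 1) (2 * 1)) x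
      (HodgeStructure.conj x) = 0 := hinj (by rw [h, map_zero])
  change BettiUniverse.trC hS 4 (LinearMap.BilinMap.baseChange ℂ (BettiUniverse.cup S 2 2) x
    (HodgeStructure.conj x)) = 0
  have hzero' : LinearMap.BilinMap.baseChange ℂ (BettiUniverse.cup S 2 2) x (HodgeStructure.conj x) = 0 :=
    hzero
  rw [hzero', map_zero]

/-! ### `H²_B(S)` is of K3 type when `h^{2,0}(S) = 1` -/

/-- Membership in the piece `V^{2,0}` of `H²_B(S)`, read on `H²(S(ℂ); ℂ)` through `Θ`.
[cite: VoisinHodgeI2002, §7.1.1] -/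
theorem mem_piece_two_zero_iff (hS : IsSmoothProjective 2 S) (x : ℂ ⊗[ℚ] bettiCohomology S (2 * 1)) :
    x ∈ (H²[hS]).piece 2 0 ↔ IsOfHodgeType 2 S (2 * 1) 2 0 (Θ[S] x) := by
  have h := BettiUniverse.mem_hodge_piece_iff exists_isReal_hodgeModel_holds
    hodgePQ_independent_of_hodgeModel_holds hS (k := 2 * 1) (p := 2) (q := 0) (by norm_num) x
  rw [bettiTwoHodgeStructure, cast_piece]
  exact_mod_cast h

/-- **`H²_B(S)` is of K3 type** when the `(2,0)`-classes of `S` form a line `ℂσ`, `σ ≠ 0`: `h^{2,0} = 1`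
and `V^{p,q} = 0` for `|p - q| > 2` (no types with a negative entry or an entry `> 2` on a surface).
[cite: Huybrechts2016K3, Ch. 3 Def. 2.3] [cite: VoisinHodgeI2002, §6.1.3] -/
theorem isOfK3Type_bettiTwo (hS : IsSmoothProjective 2 S) {σ : complexBetti S (2 * 1)}
    (hσ : IsOfHodgeType 2 S (2 * 1) 2 0 σ) (hσ0 : σ ≠ 0)
    (hline : ∀ c : complexBetti S (2 * 1), IsOfHodgeType 2 S (2 * 1) 2 0 c → ∃ t : ℂ, c = t • σ) :
    (H²[hS]).IsOfK3Type := by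
  have hI := hodgePQ_independent_of_hodgeModel_holds
  constructor
  · -- `h^{2,0} = 1`: `V^{2,0} = ℂ · Θ⁻¹σ`
    obtain ⟨t, ht⟩ := ofRatClassBaseChange_surjective hS (2 * 1) σ
    have htmem : t ∈ (H²[hS]).piece 2 0 := by
      rw [mem_piece_two_zero_iff hS, ht]
      exact hσ
    have ht0 : t ≠ 0 := by rintro rfl; exact hσ0 (by rw [← ht, map_zero])
    have hspan : (H²[hS]).piece 2 0 = ℂ ∙ t := by
      refine le_antisymm (fun x hx ↦ ?_) ((Submodule.span_singleton_le_iff_mem _ _).2 htmem)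
      rw [mem_piece_two_zero_iff hS] at hx
      obtain ⟨c, hc⟩ := hline _ hx
      rw [Submodule.mem_span_singleton]
      refine ⟨c, ofRatClassBaseChange_injective _ _ ?_⟩
      rw [map_smul, ht, ← hc]
    show Module.finrank ℂ ((H²[hS]).piece 2 0) = 1
    rw [hspan, finrank_span_singleton ht0]
  · intro p q hpq
    by_cases hsum : p + q = 2
    · -- `q = 2 - p`, `|2p - 2| > 2`: `p > 2` or `p < 0`
      have hF : ∀ r : ℤ, 2 < r → (H²[hS]).F r = ⊥ := fun r hr ↦ by
        show (BettiUniverse.hodge exists_isReal_hodgeModel_holds hS (2 * 1)).F r = ⊥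
        rw [BettiUniverse.hodge_F]
        exact HodgeModel.ratF_eq_bot _ hS (2 * 1) (by push_cast; omega)
      rcases lt_or_ge 2 p with hp | hp
      · exact eq_bot_iff.2 ((HodgeStructure.piece_le_F _ p q).trans (hF p hp).le)
      · have hq : 2 < q := by
          rcases le_or_gt 0 (p - q) with h | h
          · rw [abs_of_nonneg h] at hpq; omega
          · rw [abs_of_neg h] at hpq; omega
        refine eq_bot_iff.2 ((HodgeStructure.piece_le_complexConj_F _ p q).trans ?_)
        rw [hF q hq, HodgeStructure.complexConj_bot]
    · exact HodgeStructure.piece_eq_bot_of_add_ne _ hsum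

/-- `H²_B(S)` is polarizable (the tree's theorem `smoothProjective_hodgeStructure_isPolarizable_holds`).
[cite: VoisinHodgeI2002, Thm. 6.32 with §7.1.2] -/
theorem isPolarizable_bettiTwo (hS : IsSmoothProjective 2 S) : (H²[hS]).IsPolarizable :=
  (smoothProjective_hodgeStructure_isPolarizable_holds hS _ _ (2 * 1)).cast _

/-! ### The transcendental lattice -/

/-- **The transcendental lattice `T(S)_ℚ = Hdg¹^⊥` of a surface with `h^{2,0} = 1` underlies an
irreducible, polarizable sub-Hodge structure of K3 type of `H²_B(S)`** (Huybrechts Ch. 3 Lemma 3.1 with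
Lemma 2.7: the tree's abstract `isIrreducible_orthogonal_hodgeClasses` fed the intersection form —
symmetric, non-degenerate, `F^p ⊥ F^{3-p}`, `σ ∪ σ̄ ≠ 0`). [cite: Huybrechts2016K3, Ch. 3 Lemma 3.1 and Lemma 2.7] -/
theorem exists_transcendental_subHodgeStructure (hS : IsSmoothProjective 2 S) {σ : complexBetti S (2 * 1)}
    (hσ : IsOfHodgeType 2 S (2 * 1) 2 0 σ) (hσ0 : σ ≠ 0)
    (hline : ∀ c : complexBetti S (2 * 1), IsOfHodgeType 2 S (2 * 1) 2 0 c → ∃ t : ℂ, c = t • σ) :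
    ∃ T : SubHodgeStructure (H²[hS]), T.toSubmodule = T[hS] ∧
      T.toHodgeStructure.IsIrreducible ∧ T.toHodgeStructure.IsOfK3Type ∧
        T.toHodgeStructure.IsPolarizable := by
  haveI : Module.Finite ℚ (bettiCohomology S (2 * 1)) := BettiUniverse.finite hS (2 * 1)
  exact isIrreducible_orthogonal_hodgeClasses (isOfK3Type_bettiTwo hS hσ hσ0 hline)
    (isPolarizable_bettiTwo hS) (cupPairingBetti hS) (cupPairingBetti_isSymm hS)
    (cupPairingBetti_nondegenerate hS) (hodge_F_apply_eq_zero hS) (cupPairingBetti_twoZero_conj_ne_zero hS)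


/-! ### `Hdg¹(S)_ℂ = N¹H²(S(ℂ); ℂ)` and the rank of `T(S)_ℚ` -/

/-- **`Θ(Hdg¹(S)_ℂ) = N¹H²(S(ℂ); ℂ)`**: the complexified rational `(1,1)`-classes are exactly the
algebraic (divisor) classes — Lefschetz `(1,1)` (`lefschetzOneOne_rational_holds`) one way, "algebraic
classes are rational of type `(p,p)`" (`isOfHodgeType_of_mem_algebraicClasses_of_isSmoothProjective`,
`supportedClasses_eq_span_isRationalClass`) the other. [cite: VoisinHodgeI2002, Thm. 11.30 and §11.3.1] -/
theorem map_hodgeClasses_baseChange_eq_algebraicClasses (hS : IsSmoothProjective 2 S) :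
    (((H²[hS]).hodgeClasses 1).baseChange ℂ).map (Θ[S]) = algebraicClasses S 1 := by
  set M := BettiUniverse.realHodgeModel exists_isReal_hodgeModel_holds hS with hMdef
  have hM := BettiUniverse.realHodgeModel_isHodgeSymmetric exists_isReal_hodgeModel_holds hS
  have hI := hodgePQ_independent_of_hodgeModel_holds
  have hHdg : ∀ v : bettiCohomology S (2 * 1), v ∈ (H²[hS]).hodgeClasses 1 ↔
      IsOfHodgeType 2 S (2 * 1) 1 1 (ofRatClass (Motives.ComplexPoints S) (2 * 1) v) := fun v ↦ by
    rw [bettiTwoHodgeStructure, cast_hodgeClasses]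
    exact M.mem_hodgeClasses_iff_isOfHodgeType hS hI hM 1 v
  apply le_antisymm
  · rintro _ ⟨x, hx, rfl⟩
    obtain ⟨u, rfl⟩ := hx
    induction u using TensorProduct.induction_on with
    | zero => rw [map_zero, map_zero]; exact Submodule.zero_mem _
    | tmul c h =>
      rw [LinearMap.baseChange_tmul, Submodule.subtype_apply, ofRatClassBaseChange_tmul]
      exact Submodule.smul_mem _ c
        (lefschetzOneOne_rational_holds hS _ (isRationalClass_ofRatClass _) ((hHdg _).1 h.2))
    | add u₁ u₂ h₁ h₂ => rw [map_add, map_add]; exact Submodule.add_mem _ h₁ h₂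
  · change supportedClasses S (2 * 1) 1 ≤ _
    rw [supportedClasses_eq_span_isRationalClass hS (2 * 1) 1]
    refine Submodule.span_le.2 ?_
    rintro c ⟨hcQ, hcN⟩
    obtain ⟨a, rfl⟩ := (isRationalClass_iff_mem_range_ofRatClass c).1 hcQ
    have ha : a ∈ (H²[hS]).hodgeClasses 1 :=
      (hHdg a).2 (isOfHodgeType_of_mem_algebraicClasses_of_isSmoothProjective hS 1 hcN)
    exact ⟨(1 : ℂ) ⊗ₜ a, Submodule.tmul_mem_baseChange_of_mem 1 ha,
      by rw [ofRatClassBaseChange_tmul, one_smul]⟩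

/-- **`dim_ℚ Hdg¹(S) = dim_ℂ N¹H²(S(ℂ); ℂ) = ρ(S)`** (the Picard number). [cite: VoisinHodgeI2002, Thm. 11.30] -/
theorem finrank_hodgeClasses_one (hS : IsSmoothProjective 2 S) :
    Module.finrank ℚ ((H²[hS]).hodgeClasses 1) = Module.finrank ℂ (algebraicClasses S 1) := by
  set W := (H²[hS]).hodgeClasses 1
  have hinj := ofRatClassBaseChange_injective (Motives.ComplexPoints S) (2 * 1)
  rw [← map_hodgeClasses_baseChange_eq_algebraicClasses hS,
    ← (Submodule.equivMapOfInjective _ hinj (W.baseChange ℂ)).finrank_eq, Submodule.baseChange,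
    LinearMap.finrank_range_of_inj (baseChange_injective_of_injective W.injective_subtype),
    Module.finrank_baseChange]

/-- **`rk T(S)_ℚ = b₂(S) − ρ(S)`**: `dim_ℚ Hdg¹(S)^⊥ = dim_ℂ H²(S(ℂ); ℂ) − dim_ℂ N¹H²(S(ℂ); ℂ)`
(non-degeneracy of the intersection form). [cite: Huybrechts2016K3, Ch. 3 Lemma 3.1] -/
theorem finrank_transcendentalLatticeBetti (hS : IsSmoothProjective 2 S) :
    Module.finrank ℚ (T[hS]) =
      Module.finrank ℂ (complexBetti S (2 * 1)) - Module.finrank ℂ (algebraicClasses S 1) := by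
  haveI : Module.Finite ℚ (bettiCohomology S (2 * 1)) := BettiUniverse.finite hS (2 * 1)
  rw [transcendentalLatticeBetti, LinearMap.BilinForm.finrank_orthogonal (cupPairingBetti_nondegenerate hS),
    BettiUniverse.finrank_bettiCohomology_eq hS (2 * 1), ← finrank_hodgeClasses_one hS]
  rfl

/-! ### `End_Hdg(T(S)_ℚ) = ℚ` for `b₂ − ρ` an odd prime -/

/-- **No real or complex multiplication in odd prime rank.** For a smooth projective surface `S` with
`h^{2,0}(S) = 1` and `b₂(S) − ρ(S)` an odd prime, the transcendental lattice `T(S)_ℚ` underlies a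
sub-Hodge structure `T` of `H²_B(S)` all of whose Hodge endomorphisms are rational scalars:
`End_Hdg(T(S)_ℚ) = ℚ` (Huybrechts Rem. 3.3.14 (ii) + van Geemen Lemma 3.2, the tree's
`Hom.exists_eq_smul_id_of_prime_of_odd`). For K3 surfaces: Picard number `3, 5, 9, 11, 15, 17, 19`.
[cite: Huybrechts2016K3, Ch. 3 Rem. 3.3.14 (ii) and (3.2)] [cite: Vangeemen2008, Lemma 3.2] -/
theorem exists_transcendental_hom_eq_smul (hS : IsSmoothProjective 2 S) {σ : complexBetti S (2 * 1)}
    (hσ : IsOfHodgeType 2 S (2 * 1) 2 0 σ) (hσ0 : σ ≠ 0)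
    (hline : ∀ c : complexBetti S (2 * 1), IsOfHodgeType 2 S (2 * 1) 2 0 c → ∃ t : ℂ, c = t • σ)
    (hp : (Module.finrank ℂ (complexBetti S (2 * 1)) - Module.finrank ℂ (algebraicClasses S 1)).Prime)
    (hodd : Odd (Module.finrank ℂ (complexBetti S (2 * 1)) - Module.finrank ℂ (algebraicClasses S 1))) :
    ∃ T : SubHodgeStructure (H²[hS]), T.toSubmodule = T[hS] ∧
      ∀ f : Hom T.toHodgeStructure T.toHodgeStructure, ∃ q : ℚ,
        f.toLinearMap = q • (LinearMap.id : Module.End ℚ T.toSubmodule) := by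
  haveI : Module.Finite ℚ (bettiCohomology S (2 * 1)) := BettiUniverse.finite hS (2 * 1)
  obtain ⟨T, hT, hirr, hK3, hpol⟩ := exists_transcendental_subHodgeStructure hS hσ hσ0 hline
  obtain ⟨ψ⟩ := hpol
  have hrk : Module.finrank ℚ T.toSubmodule =
      Module.finrank ℂ (complexBetti S (2 * 1)) - Module.finrank ℂ (algebraicClasses S 1) := by
    rw [hT, finrank_transcendentalLatticeBetti hS]
  refine ⟨T, hT, fun f ↦ ?_⟩
  exact Hom.exists_eq_smul_id_of_prime_of_odd hirr hK3 ψ (hrk ▸ hp) (hrk ▸ hodd) f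

end Summit.HodgeConjecture.HodgeConjecture.Theorems.OddPrimeSquares

end
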